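import Literature.IUT.LogThetaLattice.MonoAnalyticLogShellVolumeOfTypeProofs
import Literature.NumberTheory.GaloisRepresentations.PadicResidueIndex
import HarnessLib

/-!
# [AbsTopIII] Cor 5.10 (iv)(d): the REPAIRED row `MonoAnalyticLogShellVolumeOfType L t` (FACT-LIST F-0163) is a
# schema in `L` — its universal closure over the hypothesis structure `PadicLogOnUnits` is refuted

S. Mochizuki, *Topics in absolute anabelian geometry III*, J. Math. Sci. Univ. Tokyo 22 (2015)
[MochizukiAbsTopIII2015], Cor 5.10 (iv)(d) p. 148 with Def 5.4 (iii) p. 126 and Prop 5.8 (i), (iii)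
pp. 139–140 (manuscript pages).

Negative knowledge, PROOF-ONLY (no definition, no instance), recorded next to abc-iut-L4-t15's
`MonoAnalyticLogShellVolumeOfTypeProofs.lean` (the instance form PROVED at the standard model:
`monoAnalyticLogShellVolumeOfType_ofUnitLog`, p408886) and to abc-iut-f-103's
`MonoAnalyticLogShellVolumeNegative.lean` (the unrepaired row F-0162, refuted in the type `t`).

The repaired row F-0163 (abc-iut-L4-t3, `LogShellVolumes.lean`)

  `MonoAnalyticLogShellVolumeOfType (L : PadicLogOnUnits K) (t : MLFType) : Prop :=
     t.IsTorsionExpOf K → MonoAnalyticLogShellVolume L t`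

binds ALL FOUR entries of the numerical type `t = (p, f, e, m)` to `K`, so abc-iut-f-103's `t`-witness is no
longer available.  What remains free is `L`: the hypothesis structure `PadicLogOnUnits K` records the
`p`-adic logarithm only through "the `p_k`-adic logarithm determines a bijection `1 + p*·𝒪_k ≅ p*·𝒪_k`"
(Def 5.4 (iii) p. 126) — `image_principalUnits`, `injOn_principalUnits` — and says NOTHING about `log` on
the units outside `1 + p*·𝒪_k` ("junk elsewhere", as its docstring says; the genuine logarithm is
abc-iut-S1's `PadicLogOnUnits.ofUnitLog`).  Consequently the log-shell `ℐ = (p*)⁻¹ · log(𝒪_k^×)` of a junk `L`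
can be as large as one likes, and the universal closure of F-0163 is FALSE:

* witness `K = ℚ_3`, `L = (log := x ↦ x − 1, p* := 3)`: the principal-unit clauses hold exactly
  (`x ↦ x − 1` maps `1 + 3ℤ_3` bijectively onto `3ℤ_3`), but `log(𝒪^×) = 𝒪^× − 1 = S(−1, 1)` (the unit sphere
  about `−1`), so `ℐ = 3⁻¹·S(−1,1) ⊇ ℤ_3 ⊔ (3⁻¹ + ℤ_3)` has Haar mass `≥ 2` and log-volume `≥ log 2 > 0`,
  whereas for every `m ≥ 0` the printed value at `t = (3, 1, 1, m)` is `(1·1·1 − 1 − m)·log 3 = −m·log 3 ≤ 0`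
  (`MLFType.logShellLogVolume_eq'`); all five hypotheses of `MonoAnalyticLogShellVolume L t` are met at the
  uniformizer `ϖ = 3` (`PadicUniformizer.resIndex_padic : [ℤ_3 : 3ℤ_3] = 3`), and `t.IsTorsionExpOf ℚ_3` is met
  by CHOOSING `m := v_3(#(ℚ_3^×)_tors)`;
* hence `not_forall_monoAnalyticLogShellVolumeOfType`: `¬ ∀ K … L t, MonoAnalyticLogShellVolumeOfType L t`.

So F-0163, like F-0162, is admissible ONLY in instance form — at the genuine logarithm `L = ofUnitLog p K`
(abc-iut-L4-t15's theorem, cited BY NAME, not restated).  Classical local-field bookkeeping (FACT-LIST rule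
R5: the refuted closure says the INTERFACE `PadicLogOnUnits` is lawless off the principal units, not that
the printed formula is false); nothing here bears on the disputed [IUTchIII] Cor. 3.12 or takes a side.
-/

noncomputable section

namespace Literature.IUT.LogThetaLattice

open Literature.AnabelianGeometry.AbsoluteAnabelian
open Literature.NumberTheory.GaloisRepresentations.Ultrametric
open MeasureTheory Set Metric
open scoped Pointwise

/-! ## The witness sets in `ℚ_3` (private plumbing for the two closers below) -/

section PadicThree

/-- `‖3‖_3 = 3⁻¹`. [folklore] -/
private theorem norm_three_padicThree : ‖(3 : ℚ_[3])‖ = (3 : ℝ)⁻¹ := by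
  simpa using Padic.norm_p (p := 3)

/-- `‖3⁻¹‖_3 = 3`. [folklore] -/
private theorem norm_inv_three_padicThree : ‖(3 : ℚ_[3])⁻¹‖ = 3 := by
  rw [norm_inv, norm_three_padicThree, inv_inv]

/-- `3 ≠ 0` in `ℚ_3`. [folklore] -/
private theorem three_ne_zero_padicThree : (3 : ℚ_[3]) ≠ 0 :=
  norm_pos_iff.mp (by rw [norm_three_padicThree]; norm_num)

/-- `‖2‖_3 = 1` (`3 ∤ 2`). [folklore] -/
private theorem norm_two_padicThree : ‖(2 : ℚ_[3])‖ = 1 := by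
  have h1 : ‖((2 : ℤ) : ℚ_[3])‖ ≤ 1 := Padic.norm_int_le_one 2
  have h2 : ¬ ‖((2 : ℤ) : ℚ_[3])‖ < 1 := by
    rw [Padic.norm_intCast_lt_one_iff]; decide
  push_cast at h1 h2
  exact le_antisymm h1 (not_lt.mp h2)

/-- In `ℚ_3`, `‖x‖ < 1` forces `‖x‖ ≤ ‖3‖` (the value group is `3^ℤ`). [folklore] -/
private theorem norm_le_norm_three_of_norm_lt_one (x : ℚ_[3]) (hx : ‖x‖ < 1) : ‖x‖ ≤ ‖(3 : ℚ_[3])‖ := by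
  rw [norm_three_padicThree]
  have h := (Padic.norm_le_pow_iff_norm_lt_pow_add_one x (-1)).mpr
  norm_num at h
  simpa [one_div] using h hx

/-- `‖3·y + u‖ = 1` whenever `‖y‖ ≤ 1` and `‖u‖ = 1` (ultrametric inequality, `‖3y‖ ≤ 3⁻¹ < 1`). [folklore] -/
private theorem norm_three_mul_add_eq_one {y u : ℚ_[3]} (hy : ‖y‖ ≤ 1) (hu : ‖u‖ = 1) : ‖3 * y + u‖ = 1 := by
  have hlt : ‖3 * y‖ < ‖u‖ := by
    rw [norm_mul, norm_three_padicThree, hu]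
    calc (3 : ℝ)⁻¹ * ‖y‖ ≤ 3⁻¹ * 1 := by gcongr
      _ < 1 := by norm_num
  rw [IsUltrametricDist.norm_add_eq_max_of_norm_ne_norm (ne_of_lt hlt), max_eq_right hlt.le, hu]

/-- The junk log-shell `3⁻¹ · (𝒪^× − 1)` contains `ℤ_3 = closedBall 0 1`. [folklore] -/
private theorem closedBall_zero_subset_junkShell :
    closedBall (0 : ℚ_[3]) 1 ⊆ (3 : ℚ_[3])⁻¹ • ((fun x : ℚ_[3] => x - 1) '' sphere (0 : ℚ_[3]) 1) := by
  intro y hy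
  rw [mem_closedBall, dist_zero_right] at hy
  rw [Set.mem_smul_set_iff_inv_smul_mem₀ (inv_ne_zero three_ne_zero_padicThree), inv_inv, smul_eq_mul]
  refine ⟨3 * y + 1, ?_, by ring⟩
  rw [mem_sphere, dist_zero_right]
  exact norm_three_mul_add_eq_one hy norm_one

/-- The junk log-shell `3⁻¹ · (𝒪^× − 1)` contains the translate `3⁻¹ + ℤ_3 = closedBall 3⁻¹ 1`. [folklore] -/
private theorem closedBall_third_subset_junkShell :
    closedBall ((3 : ℚ_[3])⁻¹) 1 ⊆ (3 : ℚ_[3])⁻¹ • ((fun x : ℚ_[3] => x - 1) '' sphere (0 : ℚ_[3]) 1) := by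
  intro y hy
  rw [mem_closedBall, dist_eq_norm] at hy
  rw [Set.mem_smul_set_iff_inv_smul_mem₀ (inv_ne_zero three_ne_zero_padicThree), inv_inv, smul_eq_mul]
  refine ⟨3 * y + 1, ?_, by ring⟩
  rw [mem_sphere, dist_zero_right]
  have e : (3 : ℚ_[3]) * y + 1 = 3 * (y - 3⁻¹) + 2 := by
    field_simp
    ring
  rw [e]
  exact norm_three_mul_add_eq_one hy norm_two_padicThree

/-- `ℤ_3` and `3⁻¹ + ℤ_3` are disjoint (`‖3⁻¹‖ = 3 > 1`). [folklore] -/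
private theorem disjoint_closedBall_zero_third :
    Disjoint (closedBall (0 : ℚ_[3]) 1) (closedBall ((3 : ℚ_[3])⁻¹) 1) := by
  rw [Set.disjoint_left]
  intro z hz hz'
  rw [mem_closedBall, dist_zero_right] at hz
  rw [mem_closedBall, dist_eq_norm] at hz'
  have h : ‖(3 : ℚ_[3])⁻¹‖ ≤ 1 := by
    have := IsUltrametricDist.norm_add_le_max z (-(z - 3⁻¹))
    rw [norm_neg, ← sub_eq_add_neg, sub_sub_cancel] at this
    exact this.trans (max_le hz hz')
  rw [norm_inv_three_padicThree] at h
  norm_num at h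

/-- The junk log-shell is a nonempty compact open subset of `ℚ_3` (an element of `M(ℚ_3)`): it is
`3⁻¹ · S(−1, 1)`, a dilate of a sphere of positive radius in a proper ultrametric field.
[cite: MochizukiAbsTopIII2015, Prop 5.7 (i) p. 137] -/
private theorem junkShell_mem_compactOpens :
    (3 : ℚ_[3])⁻¹ • ((fun x : ℚ_[3] => x - 1) '' sphere (0 : ℚ_[3]) 1) ∈ compactOpens ℚ_[3] := by
  have himage : (fun x : ℚ_[3] => x - 1) '' sphere (0 : ℚ_[3]) 1 = sphere (-1 : ℚ_[3]) 1 := by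
    ext y
    simp only [mem_image, mem_sphere, dist_eq_norm, sub_zero, sub_neg_eq_add]
    constructor
    · rintro ⟨x, hx, rfl⟩
      simpa using hx
    · intro hy
      exact ⟨y + 1, hy, by ring⟩
  rw [himage]
  refine ⟨?_, ?_, ?_⟩
  · exact Set.Nonempty.smul_set (⟨0, by simp⟩ : (sphere (-1 : ℚ_[3]) 1).Nonempty)
  · exact (isCompact_sphere (-1 : ℚ_[3]) 1).smul _
  · exact (IsUltrametricDist.isOpen_sphere (-1 : ℚ_[3]) one_ne_zero).smul₀
      (inv_ne_zero three_ne_zero_padicThree)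

/-- `μ_{ℚ_3}` of the junk log-shell is at least `2`: it contains the disjoint compact open pieces `ℤ_3` and
`3⁻¹ + ℤ_3`, each of normalised Haar measure `1`. [cite: MochizukiAbsTopIII2015, Prop 5.7 (i)(a) p. 137] -/
private theorem two_le_localVolume_junkShell [MeasurableSpace ℚ_[3]] [BorelSpace ℚ_[3]] :
    2 ≤ localVolume ℚ_[3] ((3 : ℚ_[3])⁻¹ • ((fun x : ℚ_[3] => x - 1) '' sphere (0 : ℚ_[3]) 1)) := by
  have hA : closedBall (0 : ℚ_[3]) 1 ∈ compactOpens ℚ_[3] :=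
    ⟨⟨0, mem_closedBall_self zero_le_one⟩, isCompact_closedBall _ _,
      IsUltrametricDist.isOpen_closedBall _ one_ne_zero⟩
  have hB : closedBall ((3 : ℚ_[3])⁻¹) 1 ∈ compactOpens ℚ_[3] :=
    ⟨⟨_, mem_closedBall_self zero_le_one⟩, isCompact_closedBall _ _,
      IsUltrametricDist.isOpen_closedBall _ one_ne_zero⟩
  have hBvol : localVolume ℚ_[3] (closedBall ((3 : ℚ_[3])⁻¹) 1) = 1 := by
    have e : closedBall ((3 : ℚ_[3])⁻¹) 1 = (3 : ℚ_[3])⁻¹ +ᵥ closedBall (0 : ℚ_[3]) 1 := by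
      rw [vadd_closedBall, vadd_eq_add, add_zero]
    rw [e, localVolume_vadd, localVolume_closedBall_one]
  have hunion : localVolume ℚ_[3] (closedBall (0 : ℚ_[3]) 1 ∪ closedBall ((3 : ℚ_[3])⁻¹) 1) = 2 := by
    rw [localVolume_union hA hB disjoint_closedBall_zero_third, localVolume_closedBall_one, hBvol]
    norm_num
  rw [← hunion]
  unfold localVolume
  exact ENNReal.toReal_mono (localHaar_lt_top_of_mem junkShell_mem_compactOpens).ne
    (measure_mono (union_subset closedBall_zero_subset_junkShell closedBall_third_subset_junkShell))

end PadicThree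

/-! ## F-0163: the universal closure is refuted -/

/-- **F-0163 is false at a junk `p`-adic-logarithm structure on `ℚ_3`:** there are `L : PadicLogOnUnits ℚ_3`
(`log := x ↦ x − 1`, `p* := 3` — the principal-unit bijection `1 + 3ℤ_3 ≅ 3ℤ_3` of Def 5.4 (iii) holds) and
a numerical type `t = (3, 1, 1, m)` WITH the binding clause `t.IsTorsionExpOf ℚ_3` such that
`MonoAnalyticLogShellVolumeOfType L t` fails: the junk log-shell has log-volume `≥ log 2 > 0 ≥ −m·log 3`.
[cite: MochizukiAbsTopIII2015, Cor 5.10 (iv)(d) p. 148] -/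
theorem exists_not_monoAnalyticLogShellVolumeOfType_padicThree [MeasurableSpace ℚ_[3]] [BorelSpace ℚ_[3]] :
    ∃ (L : PadicLogOnUnits ℚ_[3]) (t : MLFType),
      t.IsTorsionExpOf ℚ_[3] ∧ ¬ MonoAnalyticLogShellVolumeOfType L t := by
  -- the junk logarithm structure
  obtain ⟨L, hlog, hp⟩ : ∃ L : PadicLogOnUnits ℚ_[3], L.log = (fun x => x - 1) ∧ L.pstar = 3 := by
    refine ⟨{ log := fun x => x - 1
              pstar := 3
              pstar_ne_zero := three_ne_zero_padicThree
              norm_pstar_lt_one := by rw [norm_three_padicThree]; norm_num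
              image_principalUnits := ?_
              injOn_principalUnits := fun x _ y _ hxy => sub_left_injective hxy }, rfl, rfl⟩
    ext y
    simp only [mem_image, mem_closedBall, dist_eq_norm, sub_zero]
    constructor
    · rintro ⟨x, hx, rfl⟩
      exact hx
    · intro hy
      exact ⟨y + 1, by simpa using hy, by ring⟩
  -- the numerical type `(3, 1, 1, m)` with the bound fourth entry
  obtain ⟨t, htp, htf, hte, htm⟩ : ∃ t : MLFType, t.p = 3 ∧ t.f = 1 ∧ t.e = 1 ∧
      t.m = padicValNat 3 (Nat.card (CommGroup.torsion ℚ_[3]ˣ)) :=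
    ⟨⟨3, Nat.prime_three, 1, one_pos, 1, one_pos, _⟩, rfl, rfl, rfl, rfl⟩
  have ht : t.IsTorsionExpOf ℚ_[3] := by
    rw [MLFType.IsTorsionExpOf, htp, htm]
  refine ⟨L, t, ht, fun h => ?_⟩
  have hshell : logShell L = (3 : ℚ_[3])⁻¹ • ((fun x : ℚ_[3] => x - 1) '' sphere (0 : ℚ_[3]) 1) := by
    rw [logShell, preLogShell, hlog, hp]
  have hfin : LogShellFiniteVolume L := by
    rw [LogShellFiniteVolume, hshell]
    exact junkShell_mem_compactOpens
  -- all hypotheses of the row hold at the uniformizer `ϖ = 3`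
  have hconc : localLogVolume ℚ_[3] (logShell L) = t.logShellLogVolume := by
    refine h ht (PadicUniformizer.varpi 3) ?_ ?_ ?_ ?_ hfin
    · exact PadicUniformizer.norm_varpi_lt_one 3
    · intro x hx
      rw [PadicUniformizer.varpi_val, Nat.cast_ofNat]
      exact norm_le_norm_three_of_norm_lt_one x hx
    · rw [htp, htf, pow_one]
      exact PadicUniformizer.resIndex_padic 3
    · rw [hp, hte, htp, PadicUniformizer.varpi_val, Nat.cast_ofNat]
      norm_num
  -- but the junk log-shell is too big: `log μ(ℐ) ≥ log 2 > 0 ≥ −m·log 3`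
  have hpos : 0 < localLogVolume ℚ_[3] (logShell L) := by
    rw [localLogVolume, hshell]
    exact Real.log_pos (lt_of_lt_of_le (by norm_num) two_le_localVolume_junkShell)
  have hrhs : t.logShellLogVolume ≤ 0 := by
    rw [MLFType.logShellLogVolume_eq', htp, htf, hte, if_neg (by norm_num)]
    push_cast
    have h3 : (0 : ℝ) < Real.log 3 := Real.log_pos (by norm_num)
    have hm : (0 : ℝ) ≤ t.m := Nat.cast_nonneg _
    nlinarith
  linarith

/-- **FACT-LIST F-0163, universal closure REFUTED:** it is not the case that
`MonoAnalyticLogShellVolumeOfType L t` holds for every proper ultrametric normed field `K` (with its Borel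
σ-algebra), every `p`-adic-logarithm structure `L : PadicLogOnUnits K` and every numerical type `t` — witness
`K = ℚ_3`, `L = (x ↦ x − 1, 3)`, `t = (3, 1, 1, v_3 #(ℚ_3^×)_tors)`.  The instance form at the genuine logarithm
is abc-iut-L4-t15's `monoAnalyticLogShellVolumeOfType_ofUnitLog` (cited, not restated).
[cite: MochizukiAbsTopIII2015, Cor 5.10 (iv)(d) p. 148] -/
theorem not_forall_monoAnalyticLogShellVolumeOfType :
    ¬ ∀ (F : Type) [NontriviallyNormedField F] [IsUltrametricDist F] [ProperSpace F] [MeasurableSpace F]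
        [BorelSpace F] (L : PadicLogOnUnits F) (t : MLFType), MonoAnalyticLogShellVolumeOfType L t := by
  intro h
  borelize ℚ_[3]
  obtain ⟨L, t, -, hLt⟩ := exists_not_monoAnalyticLogShellVolumeOfType_padicThree
  exact hLt (h ℚ_[3] L t)

/-- … so at one and the same field `ℚ_3` the row is SATISFIABLE (genuine logarithm, abc-iut-L4-t15) and
REFUTABLE (junk logarithm) in `L`: it is a schema whose instance form only is admissible (FACT-LIST R5).
[cite: MochizukiAbsTopIII2015, Cor 5.10 (iv)(d) p. 148] -/
theorem exists_monoAnalyticLogShellVolumeOfType_and_exists_not [MeasurableSpace ℚ_[3]] [BorelSpace ℚ_[3]] :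
    (∃ (L : PadicLogOnUnits ℚ_[3]) (t : MLFType), t.IsTorsionExpOf ℚ_[3] ∧ MonoAnalyticLogShellVolumeOfType L t) ∧
      ∃ (L : PadicLogOnUnits ℚ_[3]) (t : MLFType), t.IsTorsionExpOf ℚ_[3] ∧ ¬ MonoAnalyticLogShellVolumeOfType L t :=
  ⟨⟨PadicLogOnUnits.ofUnitLog 3 ℚ_[3],
      ⟨3, Fact.out, Literature.IUT.LogVolume.residueDegree 3 ℚ_[3], Literature.IUT.LogVolume.residueDegree_pos 3 ℚ_[3],
        Literature.IUT.LogVolume.absRamificationIdx 3 ℚ_[3], Literature.IUT.LogVolume.absRamificationIdx_pos 3 ℚ_[3],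
        Literature.IUT.LogVolume.torsionPExp 3 ℚ_[3]⟩,
      rfl, monoAnalyticLogShellVolumeOfType_ofUnitLog 3 ℚ_[3] _ rfl rfl rfl⟩,
    exists_not_monoAnalyticLogShellVolumeOfType_padicThree⟩

end Literature.IUT.LogThetaLattice

end
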